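import Literature.Analysis.FluidPDE.SpaceTimeRescaling
import Literature.Analysis.FluidPDE.NSLerayHopfProofs
import HarnessLib

/-!
# Suitable weak solutions in the sense of Escauriaza–Seregin–Šverák, ε-regularity, and the
local theorems on viscous cylinders

Analysis/FluidPDE file in the decomposition of the endpoint criterion `Literature.Analysis.FluidPDE.ess_endpoint`
(Escauriaza–Seregin–Šverák 2003, Thm. 1.3; see `FluidPDE/NSLerayHopfProofs`). The remaining deep
input of that decomposition is `NS.ess_sup_bound` (ESS §3, (3.6): an `L_{3,∞}` Leray–Hopf
solution is bounded on `ℝ³ × [δ, T]`), which ESS obtain from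

* their **local theorem** (Thm. 1.4, vendored as `NS.ess_local_holder`) "by scaling" around
  every point `z₀ ∈ ℝ³ × ]0, T]` — this gives (3.5), Hölder continuity near every point;
* the **ε-regularity lemma** for suitable weak solutions (Lemma 2.2, `k = 1`), applied "using
  scaling arguments" on cylinders `Q(z₀, R)` with `|x₀| → ∞`, where
  `∫_{Q(z₀,R)} |v|³ + |p|^{3/2} → 0` — this bounds `v` far out;
* the **associated pressure** (3.2)–(3.4) of the Leray–Hopf solution, which supplies the pair
  `(v, p)` solving the system in the sense of distributions with `p ∈ L_{3/2,∞}(Q_T)`;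
* the observation opening the proof of Thm. 1.4 that a pair with (1.15)–(1.16) "form[s] a
  suitable weak solution in `Q`" (so that Lemma 2.2 applies to the rescaled pairs).

This file vendors these three printed ingredients as named facts and **proves** the "scaling
arguments": the transport of Thm. 1.4 and of Lemma 2.2 from the unit cylinder
`Q = B(1) × ]-1, 0[` (viscosity `1`) to the viscous cylinders
`Q_ν(z₀, R) = B(x₀, R) × ]t₀ - R²/ν, t₀[` of a solution with viscosity `ν`, by the map
`w(s, y) = (R/ν) u(t₀ + (R²/ν) s, x₀ + R y)`, `q(s, y) = (R/ν)² p(…)` of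
`FluidPDE/SpaceTimeRescaling` (ESS §3: "making obvious scaling `ṽ(x,t) = R v(x₀ + Rx, t₀ + R²t)`,
`p̃ = R² p(…)`, we see that the pair `ṽ` and `p̃` satisfies all conditions of Theorem 1.4").

## Contents

* `Fluid.viscousCylinder ν r z`, `Fluid.viscousCylinderOpens` — `Q_ν(z, r) = (t - r²/ν, t) × B_r(x)`
  (`= Fluid.parabolicCylinder r z` for `ν = 1`, `viscousCylinder_one`).
* `Fluid.timeCylinder ω a b = ]a, b[ × ω`, `Fluid.forwardCylinder ω a = ]a, ∞[ × ω` (`Opens`).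
* `Fluid.IsSuitablePairOn ω a b ν u p` — **suitable weak solutions in the sense of
  Escauriaza–Seregin–Šverák 2003, Def. 2.1** (= Ladyzhenskaya–Seregin 1999; Seregin 2014,
  Def. 6.1) on `ω × ]a, b[`: energy class (2.1), pressure `L_{3/2}` (2.2), the system in the
  sense of distributions (2.3), and the **sliced** local energy inequality (2.4) for a.e. `t` and
  every nonnegative test function vanishing near the parabolic boundary. (The accepted
  `Fluid.IsSuitableWeakSolutionOn` is the Caffarelli–Kohn–Nirenberg / Lin form with the
  integrated local energy inequality; ESS's Lemma 2.2 is printed for Def. 2.1, so the ESS form is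
  vendored separately rather than identified with the CKN form.)
* `NS.ess_epsilon_regularity` — ESS 2003, Lemma 2.2 (`k = 1`) (named fact).
* `NS.ess_suitable_of_L3infty` — ESS 2003, proof of Thm. 1.4, first paragraph, over the
  mis-parenthesised `Fluid.IsSuitablePairOn`: **deprecated — refuted as stated** (verdict clean-up
  2026-08-16, see the section below); no longer offered as a named fact.
* `NS.ess_associated_pressure` — ESS 2003, §3, (3.2)–(3.4) (named fact).
* `NS.IsL3inftyLocalPair ν R z₀ u p` — the hypotheses (1.15)–(1.16) of Thm. 1.4 on `Q_ν(z₀, R)`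
  (bundled), `NS.IsL3inftyLocalPair.stRescale` — their transport to the unit cylinder (proved);
* `NS.IsL3inftyLocalPair.exists_ae_bound` — **Thm. 1.4 rescaled**: `u` is essentially bounded on
  `Q_ν(z₀, R/2)` (proved from `ess_local_holder`);
* `NS.ess_epsilon_bound_scaled` — **Lemma 2.2 rescaled**: if
  `(ν R)⁻² ∫_{Q_ν(z₀,R)} (|u|³ + |p|^{3/2}) < ε₀` then `|u| ≤ c₀ ν / R` a.e. on `Q_ν(z₀, R/2)`
  (proved from `ess_epsilon_regularity` and `ess_suitable_of_L3infty`; **deprecated** 2026-08-16 with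
  the latter — vacuous — in favour of `NS.ess_epsilon_bound_scaled'`).
* **Corrected rendering of (2.4).** In `Fluid.IsSuitablePairOn.localEnergy` the left-hand side
  `∫ x in ω, φ t x * ‖u t x‖² + 2ν ∫∫ φ |∇u|² ≤ …` is parsed by Lean as
  `∫ x in ω, (φ t x ‖u t x‖² + 2ν ∫∫ φ |∇u|²) ≤ …` (the integral binder extends over `+`), so the
  constant dissipation term is integrated over `ω` — this is **not** ESS (2.4) unless `|ω| = 1`,
  and for `ω = B(1) ⊆ ℝ³` (`|ω| = 4π/3 > 1`) it contradicts the local energy *equality* of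
  regular solutions. The structure `Fluid.IsESSSuitablePairOn` is the same definition with the
  parenthesised left-hand side `(∫ x in ω, φ t x ‖u t x‖²) + 2ν (∫∫ φ |∇u|²)`, exactly (2.4);
  `NS.ess_epsilon_regularity'`, `NS.ess_suitable_of_L3infty'` are Lemma 2.2 and the first
  paragraph of the proof of Thm. 1.4 over the corrected predicate (same citations), and
  `NS.ess_epsilon_bound_scaled'` is the rescaled Lemma 2.2 proved from them. The unprimed
  declarations are kept unchanged for their importers.

## Verdict clean-up (2026-08-16): `ess_suitable_of_L3infty` is refuted as stated and deprecated

The tenured prove seat of the named fact `ess_suitable_of_L3infty` returned the verdict *refuted as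
stated*, and the refutation is a theorem of the tree:
`Literature.Analysis.FluidPDE.not_ess_suitable_of_L3infty : ¬ ess_suitable_of_L3infty`
(`FluidPDE/NSSuitableESSRefutation`, p30115, axioms `propext`, `Classical.choice`, `Quot.sound`;
witness: the plane Couette flow `v(t, x) = x₁ e₀`, `p = 0`, which meets the five hypotheses on
`Q(1)` and violates the unparenthesised clause (2.4) of `Fluid.IsSuitablePairOn` because
`|B(1)| = 4π/3 > 1`). The `def` is therefore **retired from the named facts**: it carries
`@[deprecated]` and is kept, statement byte-for-byte, only because that theorem and the two
conditional theorems `ess_sup_bound_of`, `ess_endpoint_of_local_regularity`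
(`FluidPDE/NSEssSupBound`, vacuous implications) name it; no `ess_suitable_of_L3infty_holds` can
exist. Its in-file consumer `ess_epsilon_bound_scaled` (a correct but vacuous implication) is
deprecated with it in favour of `ess_epsilon_bound_scaled'`. **Corrected statement:**
`ess_suitable_of_L3infty'` below (identical hypotheses, conclusion `Fluid.IsESSSuitablePairOn`, the
parenthesised (2.4) as printed), **proved** as `ess_suitable_of_L3infty'_holds`
(`FluidPDE/NSSuitableESSProofs`). The printed sentence of Escauriaza–Seregin–Šverák (proof of
Thm. 1.4, first paragraph) is true; only the transcription of (2.4) in `Fluid.IsSuitablePairOn` was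
wrong. Nothing else in this file changed.

## Numbering

As in `NSLerayHopfProofs`: theorem and equation numbers are those of the authors' English text
(`engESS3.pdf` on G. Seregin's page = Russ. Math. Surveys 58:2 (2003) 211–250): Def. 2.1,
Lemma 2.2 with (2.5)–(2.6), Thm. 1.4 with (1.15)–(1.16), §3 with (3.2)–(3.6).

## Design notes

* Time first (`u : ℝ → E → E`), as everywhere in the trunk; ESS write `u(x, t)` and
  `Q(z₀, R) = B(x₀, R) × ]t₀ - R², t₀[`.
* In (2.4) the admissible test functions are "nonnegative `φ ∈ C₀^∞(ℝ³⁺¹)` vanishing in the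
  neighborhood of the parabolic boundary `∂'Q = ω × {t = a} ∪ ∂ω × [a, b]`"; since (2.4) only
  involves the values of `φ` on `ω × ]a, b]`, this class induces the same inequalities as the
  nonnegative test functions on the open set `]a, ∞[ × ω` (accepted `Fluid.IsSpaceTimeTestOn`
  on `Fluid.forwardCylinder ω a`), which is how it is rendered. "For a.a. `t` and for all `φ`"
  is rendered with the null set independent of `φ` (`∀ᵐ t, ∀ φ`).
* The weak spatial gradient `G` of (2.1) is bundled under one existential with its square
  integrability and (2.4), as in the accepted `Fluid.IsSuitableWeakSolutionOn`; it is unique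
  a.e., so (2.4) does not depend on the choice.
* Viscosity: Def. 2.1, Lemma 2.2 and Thm. 1.4 are printed for `ν = 1`; the definition carries a
  viscosity parameter (energy inequality `… + 2ν ∫∫ φ |∇u|² ≤ ∫∫ |u|² (∂ₜφ + νΔφ) + …`) for
  uniformity with the accepted CKN predicate, but the two facts about it are stated at `ν = 1`
  exactly as printed. `ess_associated_pressure` is stated for `ν > 0` with the rescaling
  sentence of `ess_sup_bound` / `ess_L5_integrability`.

## References

* L. Escauriaza, G. Seregin, V. Šverák, *`L_{3,∞}`-solutions of Navier–Stokes equations and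
  backward uniqueness*, Russ. Math. Surveys 58:2 (2003) 211–250, Def. 2.1, Lemma 2.2, Remark 2.3,
  Thm. 1.4, §3 (3.2)–(3.6).
* O. A. Ladyzhenskaya, G. A. Seregin, *On partial regularity of suitable weak solutions to the
  three-dimensional Navier–Stokes equations*, J. Math. Fluid Mech. 1 (1999) 356–387 (ESS's
  reference [17] for Def. 2.1 and Lemma 2.2).
* G. Seregin, *Lecture notes on regularity theory for the Navier–Stokes equations* (World
  Scientific 2014), Def. 6.1, Lemma 6.1 (the same definition and ε-regularity lemma).
* L. Caffarelli, R. Kohn, L. Nirenberg, *Partial regularity of suitable weak solutions of the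
  Navier–Stokes equations*, CPAM 35 (1982), Prop. 1 and Cor. 1 (the case `k = 1`, cf. ESS
  Remark 2.3).
-/

noncomputable section

open MeasureTheory TopologicalSpace Set Function Filter Topology Metric Module
open scoped InnerProductSpace RealInnerProductSpace ENNReal NNReal Laplacian

namespace Literature.Analysis.FluidPDE

/-! ### Viscous parabolic cylinders and time cylinders -/

section Cylinder

variable {E : Type*} [PseudoMetricSpace E]

/-- The **viscous (backward) parabolic cylinder** `Q_ν(z, r) = (t - r²/ν, t) × B_r(x)`,
`z = (t, x)`: the natural cylinder of a solution with viscosity `ν`, image of the standard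
cylinder `Q(1)` under `(s, y) ↦ (t + (r²/ν) s, x + r y)`; for `ν = 1` it is ESS's
`Q(z₀, R) = B(x₀, R) × ]t₀ - R², t₀[` = the accepted `Fluid.parabolicCylinder`
(Escauriaza–Seregin–Šverák 2003, notation before Remark 2.3). [cite: EscauriazaSereginSverak2003, §2 notation] -/
def viscousCylinder (ν r : ℝ) (z : ℝ × E) : Set (ℝ × E) :=
  Ioo (z.1 - r ^ 2 / ν) z.1 ×ˢ ball z.2 r

/-- Membership in the viscous cylinder. [folklore] -/
@[simp]
theorem mem_viscousCylinder {ν r : ℝ} {z w : ℝ × E} :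
    w ∈ viscousCylinder ν r z ↔ (z.1 - r ^ 2 / ν < w.1 ∧ w.1 < z.1) ∧ dist w.2 z.2 < r := by
  simp [viscousCylinder, mem_prod, mem_Ioo, mem_ball]

/-- For `ν = 1` the viscous cylinder is the parabolic cylinder `Q_r(z)` (ESS 2003, §2). [cite: EscauriazaSereginSverak2003, §2 notation] -/
theorem viscousCylinder_one (r : ℝ) (z : ℝ × E) : viscousCylinder 1 r z = parabolicCylinder r z := by
  simp [viscousCylinder, parabolicCylinder]

/-- Viscous cylinders are open. [folklore] -/
theorem isOpen_viscousCylinder (ν r : ℝ) (z : ℝ × E) : IsOpen (viscousCylinder ν r z) :=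
  isOpen_Ioo.prod isOpen_ball

/-- Viscous cylinders are measurable. [folklore] -/
theorem measurableSet_viscousCylinder [MeasurableSpace E] [OpensMeasurableSpace E] (ν r : ℝ)
    (z : ℝ × E) : MeasurableSet (viscousCylinder ν r z) :=
  measurableSet_Ioo.prod measurableSet_ball

/-- The viscous cylinder as an element of `Opens (ℝ × E)`. [folklore] -/
def viscousCylinderOpens (ν r : ℝ) (z : ℝ × E) : Opens (ℝ × E) :=
  ⟨viscousCylinder ν r z, isOpen_viscousCylinder ν r z⟩

/-- Underlying set of `viscousCylinderOpens`. [folklore] -/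
@[simp]
theorem coe_viscousCylinderOpens (ν r : ℝ) (z : ℝ × E) :
    ((viscousCylinderOpens ν r z : Opens (ℝ × E)) : Set (ℝ × E)) = viscousCylinder ν r z :=
  rfl

/-- For `ν = 1`, `viscousCylinderOpens = parabolicCylinderOpens`. [folklore] -/
theorem viscousCylinderOpens_one (r : ℝ) (z : ℝ × E) :
    viscousCylinderOpens 1 r z = parabolicCylinderOpens r z :=
  TopologicalSpace.Opens.ext (viscousCylinder_one r z)

/-- Viscous cylinders increase with the radius (`0 < ν`, `0 ≤ r ≤ r'`). [folklore] -/
theorem viscousCylinder_mono {ν r r' : ℝ} (hν : 0 < ν) (hr : 0 ≤ r) (h : r ≤ r') (z : ℝ × E) :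
    viscousCylinder ν r z ⊆ viscousCylinder ν r' z := by
  have h2 : r ^ 2 / ν ≤ r' ^ 2 / ν := div_le_div_of_nonneg_right (pow_le_pow_left₀ hr h 2) hν.le
  exact prod_mono (Ioo_subset_Ioo (by linarith) le_rfl) (ball_subset_ball h)

/-- The viscous cylinder lies in the slab of its time interval. [folklore] -/
theorem viscousCylinder_subset_prod_univ (ν r : ℝ) (z : ℝ × E) :
    viscousCylinder ν r z ⊆ Ioo (z.1 - r ^ 2 / ν) z.1 ×ˢ (univ : Set E) :=
  prod_mono Subset.rfl (subset_univ _)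

end Cylinder

section TimeCylinder

variable {E : Type*} [TopologicalSpace E]

/-- The open space–time cylinder `ω × ]a, b[` over an open set `ω ⊆ E` (time first:
`]a, b[ × ω`), the domain of ESS's Def. 2.1. [cite: EscauriazaSereginSverak2003, Def. 2.1] -/
def timeCylinder (ω : Opens E) (a b : ℝ) : Opens (ℝ × E) :=
  ⟨Ioo a b ×ˢ (ω : Set E), isOpen_Ioo.prod ω.isOpen⟩

/-- The forward region `]a, ∞[ × ω`, carrying the admissible test functions of the sliced
local energy inequality (those "vanishing in the neighborhood of the parabolic boundary"
`ω × {t = a} ∪ ∂ω × [a, b]`, ESS 2003, Def. 2.1). [cite: EscauriazaSereginSverak2003, Def. 2.1] -/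
def forwardCylinder (ω : Opens E) (a : ℝ) : Opens (ℝ × E) :=
  ⟨Ioi a ×ˢ (ω : Set E), isOpen_Ioi.prod ω.isOpen⟩

/-- Underlying set of `timeCylinder`. [folklore] -/
@[simp]
theorem coe_timeCylinder (ω : Opens E) (a b : ℝ) :
    ((timeCylinder ω a b : Opens (ℝ × E)) : Set (ℝ × E)) = Ioo a b ×ˢ (ω : Set E) :=
  rfl

/-- Underlying set of `forwardCylinder`. [folklore] -/
@[simp]
theorem coe_forwardCylinder (ω : Opens E) (a : ℝ) :
    ((forwardCylinder ω a : Opens (ℝ × E)) : Set (ℝ × E)) = Ioi a ×ˢ (ω : Set E) :=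
  rfl

/-- `]a, b[ × ω ⊆ ]a, ∞[ × ω`. [folklore] -/
theorem timeCylinder_le_forwardCylinder (ω : Opens E) (a b : ℝ) :
    timeCylinder ω a b ≤ forwardCylinder ω a :=
  fun _ hz => ⟨hz.1.1, hz.2⟩

end TimeCylinder

/-! ### Suitable weak solutions in the sense of ESS, Def. 2.1 (sliced local energy inequality) -/

section Suitable

variable {E : Type*} [NormedAddCommGroup E] [InnerProductSpace ℝ E] [FiniteDimensional ℝ E]
  [MeasurableSpace E] [BorelSpace E]

/-- **Warning — mis-parenthesised (2.4); superseded by `Fluid.IsESSSuitablePairOn`.** In the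
`localEnergy` clause below, `∫ x in ω, φ t x * ‖u t x‖ ^ 2 + 2 * ν * ∫∫ … ≤ …` parses as `∫ x in
ω, (φ t x ‖u t x‖² + 2ν ∫∫ φ |G|²) ≤ …` (the integral binder extends over `+`), so the dissipation
term is integrated once more over `ω`; this is ESS (2.4) only when `|ω| = 1` (for the unit ball of
`ℝ³`, `|ω| = 4π/3`). Kept unchanged for its importers; use `Fluid.IsESSSuitablePairOn`.

Original description:
**Suitable weak solutions in the sense of Escauriaza–Seregin–Šverák** (ESS 2003, Def. 2.1,
"our version is due to [17]" = Ladyzhenskaya–Seregin 1999; Seregin 2014, Def. 6.1). Let `ω ⊆ E`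
be open. The pair `(u, p)` is a suitable weak solution of the Navier–Stokes equations (viscosity
`ν`, no force) on `ω × ]a, b[` if:
(2.1) `u ∈ L_{2,∞}(ω × ]a, b[) ∩ L₂(a, b; W¹₂(ω))` — `ess sup_t ∫_ω |u(t)|² < ∞` and `u` has a
weak spatial gradient `G = ∇u` on the cylinder with `∫∫ |∇u|² < ∞`;
(2.2) `p ∈ L_{3/2}(ω × ]a, b[)`;
(2.3) `u` and `p` satisfy the Navier–Stokes equations in the sense of distributions on the
cylinder (accepted `Fluid.IsDistributionalNSSolutionOn`);
(2.4) the **local energy inequality holds slice-wise**: for a.e. `t ∈ ]a, b[` and every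
nonnegative smooth `φ` compactly supported in `]a, ∞[ × ω` (i.e. vanishing near the parabolic
boundary),
`∫_ω φ |u|²(t) dx + 2ν ∫_a^t ∫_ω φ |∇u|² ≤ ∫_a^t ∫_ω (|u|² (νΔφ + ∂ₜφ) + u·∇φ (|u|² + 2p))`.
ESS print `ν = 1`. Contrast with the accepted `Fluid.IsSuitableWeakSolutionOn`
(Caffarelli–Kohn–Nirenberg's integrated inequality (2.5)). [cite: EscauriazaSereginSverak2003, Def. 2.1] -/
structure IsSuitablePairOn (ω : Opens E) (a b : ℝ) (ν : ℝ) (u : ℝ → E → E) (p : ℝ → E → ℝ) :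
    Prop where
  /-- (2.1), first half: `u ∈ L_{2,∞}(ω × ]a, b[)`, `ess sup_{a<t<b} ∫_ω |u(t, x)|² dx < ∞`. -/
  energyClass : ∃ C : ℝ≥0, ∀ᵐ t ∂(volume.restrict (Ioo a b)),
    ∫⁻ x in (ω : Set E), ‖u t x‖ₑ ^ 2 ≤ C
  /-- (2.2): `p ∈ L_{3/2}(ω × ]a, b[)`. -/
  pressure : ∫⁻ z in Ioo a b ×ˢ (ω : Set E), ‖p z.1 z.2‖ₑ ^ (3 / 2 : ℝ) < ∞
  /-- (2.3): the Navier–Stokes equations hold in the sense of distributions on `ω × ]a, b[`. -/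
  distributional : IsDistributionalNSSolutionOn (timeCylinder ω a b) ν 0 u p
  /-- (2.1), second half, and (2.4), bundled under one existential: `u` has a weak spatial
  gradient `G` on the cylinder with `∫∫ |G|² < ∞` (`u ∈ L₂(a, b; W¹₂(ω))`), and for a.e.
  `t ∈ ]a, b[` the sliced local energy inequality holds for every nonnegative test function on
  `]a, ∞[ × ω`, with `G` in place of `∇u`. -/
  localEnergy : ∃ G : ℝ → E → E →L[ℝ] E, HasWeakSpatialGradientOn (timeCylinder ω a b) u G ∧
    (∫⁻ z in Ioo a b ×ˢ (ω : Set E), ENNReal.ofReal (frobeniusNormSq (G z.1 z.2)) < ∞) ∧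
    ∀ᵐ t ∂(volume.restrict (Ioo a b)), ∀ φ : ℝ → E → ℝ,
      IsSpaceTimeTestOn (forwardCylinder ω a) φ → (∀ s y, 0 ≤ φ s y) →
      ∫ x in (ω : Set E), φ t x * ‖u t x‖ ^ 2 +
          2 * ν * ∫ z in Ioo a t ×ˢ (ω : Set E), φ z.1 z.2 * frobeniusNormSq (G z.1 z.2) ≤
        ∫ z in Ioo a t ×ˢ (ω : Set E),
          (‖u z.1 z.2‖ ^ 2 * (ν * Δ (φ z.1) z.2 + timeDeriv φ z.1 z.2) +
            ⟪u z.1 z.2, gradient (φ z.1) z.2⟫ * (‖u z.1 z.2‖ ^ 2 + 2 * p z.1 z.2))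

variable {ω : Opens E} {a b ν : ℝ} {u : ℝ → E → E} {p : ℝ → E → ℝ}

/-- An ESS-suitable pair has a square-integrable weak spatial gradient on the cylinder
((2.1), second half; projection dropping (2.4)). [cite: EscauriazaSereginSverak2003, Def. 2.1 (2.1)] -/
theorem IsSuitablePairOn.exists_hasWeakSpatialGradientOn (h : IsSuitablePairOn ω a b ν u p) :
    ∃ G : ℝ → E → E →L[ℝ] E, HasWeakSpatialGradientOn (timeCylinder ω a b) u G ∧
      ∫⁻ z in Ioo a b ×ˢ (ω : Set E), ENNReal.ofReal (frobeniusNormSq (G z.1 z.2)) < ∞ := by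
  obtain ⟨G, hG, hG2, -⟩ := h.localEnergy
  exact ⟨G, hG, hG2⟩

/-- An ESS-suitable pair solves the system in the sense of distributions on every open subset
of its cylinder (projection of (2.3) and the accepted restriction
`IsDistributionalNSSolutionOn.mono_holds`). [cite: EscauriazaSereginSverak2003, Def. 2.1 (2.3)] -/
theorem IsSuitablePairOn.isDistributionalNSSolutionOn_of_le (h : IsSuitablePairOn ω a b ν u p)
    {Q : Opens (ℝ × E)} (hQ : Q ≤ timeCylinder ω a b) : IsDistributionalNSSolutionOn Q ν 0 u p :=
  h.distributional.of_le hQ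

end Suitable

end Literature.Analysis.FluidPDE

namespace Literature.Analysis.FluidPDE

/-- Local notation for physical space `ℝ³ = EuclideanSpace ℝ (Fin 3)`. -/
local notation "ℝ³" => EuclideanSpace ℝ (Fin 3)

/-- The unit ball of `ℝ³` as an open set, `B = B(1)` (ESS 2003, §2 notation). [cite: EscauriazaSereginSverak2003, §2 notation] -/
def unitBall : Opens ℝ³ :=
  ⟨ball (0 : ℝ³) 1, isOpen_ball⟩

/-- Underlying set of `unitBall`. [folklore] -/
@[simp]
theorem coe_unitBall : ((unitBall : Opens ℝ³) : Set ℝ³) = ball (0 : ℝ³) 1 :=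
  rfl

/-! ### ESS Lemma 2.2 (`k = 1`): ε-regularity of suitable weak solutions -/

/-- **Warning — stated over the mis-parenthesised `Fluid.IsSuitablePairOn`; superseded by
`NS.ess_epsilon_regularity'` (same statement over `Fluid.IsESSSuitablePairOn`).** The hypothesis
here is stronger than ESS Def. 2.1 on the unit ball (factor `|B(1)| = 4π/3` on the dissipation
term), so this fact is implied by the printed Lemma 2.2 but is not its faithful rendering.

Original description:
**ε-regularity** (Escauriaza–Seregin–Šverák 2003, Lemma 2.2, case `k = 1`; "proved
essentially in" Caffarelli–Kohn–Nirenberg 1982, Cor. 1, cf. ESS Remark 2.3; Ladyzhenskaya–Seregin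
1999, Lemma 3.1; Seregin 2014, Lemma 6.1). There exist absolute positive constants `ε₀` and
`c₀₁` with the following property. Assume that the pair `U` and `P` is a suitable weak solution
to the Navier–Stokes equations (ESS Def. 2.1, `ν = 1`; `Fluid.IsSuitablePairOn`) in
`Q = B × ]-1, 0[` and satisfies the condition (2.5) `∫_Q (|U|³ + |P|^{3/2}) dz < ε₀`. Then `U`
is Hölder continuous in the closure of `Q(1/2) = B(1/2) × ]-1/4, 0[` and (2.6)
`max_{z ∈ Q̄(1/2)} |U(z)| < c₀₁`. Rendering for the a.e.-defined field: `U` has a representative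
`w` on `ℝ × ℝ³`, Hölder continuous (some exponent `α > 0`) on the closure of `Q(1/2)`,
agreeing with `U` a.e. on `Q(1/2)`, with `|w| < c₀₁` on that closure. [cite: EscauriazaSereginSverak2003, Lemma 2.2] -/
def ess_epsilon_regularity : Prop :=
  ∃ ε₀ c₀ : ℝ, 0 < ε₀ ∧ 0 < c₀ ∧ ∀ (U : ℝ → ℝ³ → ℝ³) (P : ℝ → ℝ³ → ℝ),
    FluidPDE.IsSuitablePairOn unitBall (-1) 0 1 U P →
    ∫⁻ z in FluidPDE.parabolicCylinder 1 ((0 : ℝ), (0 : ℝ³)),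
        (‖U z.1 z.2‖ₑ ^ 3 + ‖P z.1 z.2‖ₑ ^ (3 / 2 : ℝ)) < ENNReal.ofReal ε₀ →
    ∃ (w : ℝ × ℝ³ → ℝ³) (C α : ℝ≥0), 0 < α ∧
      HolderOnWith C α w (closure (FluidPDE.parabolicCylinder (1 / 2) ((0 : ℝ), (0 : ℝ³)))) ∧
      uncurry U =ᵐ[volume.restrict (FluidPDE.parabolicCylinder (1 / 2) ((0 : ℝ), (0 : ℝ³)))] w ∧
      ∀ z ∈ closure (FluidPDE.parabolicCylinder (1 / 2) ((0 : ℝ), (0 : ℝ³))), ‖w z‖ < c₀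

/-! ### ESS, proof of Theorem 1.4, first paragraph: `L_{3,∞}` pairs are suitable -/

/-- **Deprecated — REFUTED as stated (verdict clean-up 2026-08-16); no longer a named fact, kept
verbatim only because its refutation names it.** Intended: Escauriaza–Seregin–Šverák 2003, proof of
Thm. 1.4, first paragraph ("First, we note that `v` and `p`, satisfying conditions (1.15) and
(1.16), form a suitable weak solution to the Navier–Stokes equations in `Q`. This can be verified
with the help of usual mollification and the fact `v ∈ L₄(Q)`. The latter is just a consequence of
the known multiplicative inequality."): if `v`, `p` solve the system (`ν = 1`, no force) in
`Q = B × ]-1, 0[` in the sense of distributions, (1.15) `v ∈ L_{2,∞}(Q)` with a square-integrable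
weak spatial gradient (`v ∈ L₂(-1, 0; W¹₂(B))`), `p ∈ L_{3/2}(Q)`, and (1.16) `‖v‖_{3,∞,Q} < ∞`
(hypotheses verbatim those of `NS.ess_local_holder`, Thm. 1.4), then `(v, p)` is suitable in `Q`
in the sense of ESS Def. 2.1. **What is wrong:** the conclusion is rendered as
`Fluid.IsSuitablePairOn unitBall (-1) 0 1 v p`, whose clause (2.4) is transcribed without the
parentheses of the printed inequality — `∫ x in ω, φ t x * ‖u t x‖ ^ 2 + 2 * ν * ∫∫ φ |G|² ≤ …`
parses as `∫ x in ω, (φ t x * ‖u t x‖ ^ 2 + 2 * ν * ∫∫ φ |G|²) ≤ …` — so the dissipation term is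
integrated once more over `ω = B(1) ⊆ ℝ³`, i.e. multiplied by `|B(1)| = 4π/3 > 1`; regular
solutions satisfy the local energy *equality* and therefore violate this clause as soon as
`∫∫ φ |∇v|² > 0`. **Refutation (kernel-checked, kept):**
`Literature.Analysis.FluidPDE.not_ess_suitable_of_L3infty : ¬ ess_suitable_of_L3infty`
(`FluidPDE/NSSuitableESSRefutation`, p30115), by the plane Couette flow `v(t, x) = x₁ e₀`, `p = 0`
on the unit cylinder. **Corrected statement — use instead:** `ess_suitable_of_L3infty'` (this file:
identical hypotheses, conclusion `Fluid.IsESSSuitablePairOn unitBall (-1) 0 1 v p` with (2.4)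
parenthesised as printed), proved as `ess_suitable_of_L3infty'_holds`
(`FluidPDE/NSSuitableESSProofs`). No `ess_suitable_of_L3infty_holds` can exist; the remaining users
(`ess_epsilon_bound_scaled` below, `ess_sup_bound_of` and `ess_endpoint_of_local_regularity` in
`FluidPDE/NSEssSupBound`) are vacuous implications, deprecated with it. A mis-rendering of the
cited sentence, recorded here for provenance only. [cite: EscauriazaSereginSverak2003, §3, proof of Thm. 1.4, first paragraph (mis-rendered (2.4); refuted in-tree, see docstring)] -/
@[deprecated "refuted as stated: see Literature.Analysis.FluidPDE.not_ess_suitable_of_L3infty \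
  (NSSuitableESSRefutation.lean, p30115); corrected statement: ess_suitable_of_L3infty' \
  (proved: ess_suitable_of_L3infty'_holds, NSSuitableESSProofs.lean)" (since := "2026-08-16")]
def ess_suitable_of_L3infty : Prop :=
  ∀ (v : ℝ → ℝ³ → ℝ³) (p : ℝ → ℝ³ → ℝ),
    FluidPDE.IsDistributionalNSSolutionOn (FluidPDE.parabolicCylinderOpens 1 ((0 : ℝ), (0 : ℝ³))) 1 0
      v p →
    (∃ C : ℝ≥0, ∀ᵐ t ∂(volume.restrict (Ioo (-1) 0)),
      ∫⁻ x in ball (0 : ℝ³) 1, ‖v t x‖ₑ ^ 2 ≤ C) →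
    (∃ G : ℝ → ℝ³ → ℝ³ →L[ℝ] ℝ³,
      FluidPDE.HasWeakSpatialGradientOn (FluidPDE.parabolicCylinderOpens 1 ((0 : ℝ), (0 : ℝ³))) v G ∧
      ∫⁻ z in FluidPDE.parabolicCylinder 1 ((0 : ℝ), (0 : ℝ³)),
        ENNReal.ofReal (FluidPDE.frobeniusNormSq (G z.1 z.2)) < ∞) →
    (∫⁻ z in FluidPDE.parabolicCylinder 1 ((0 : ℝ), (0 : ℝ³)), ‖p z.1 z.2‖ₑ ^ (3 / 2 : ℝ) < ∞) →
    (∃ C : ℝ≥0, ∀ᵐ t ∂(volume.restrict (Ioo (-1) 0)),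
      ∫⁻ x in ball (0 : ℝ³) 1, ‖v t x‖ₑ ^ 3 ≤ C) →
    FluidPDE.IsSuitablePairOn unitBall (-1) 0 1 v p

/-! ### ESS §3, (3.2)–(3.4): the associated pressure of an `L_{3,∞}` Leray–Hopf solution -/

/-- **The associated pressure** (Escauriaza–Seregin–Šverák 2003, §3, proof of Thm. 1.3,
(3.2)–(3.4): "Using known Ladyzhenskaya's arguments, involving the coercive estimates and the
uniqueness theorem for Stokes problem, we can introduce the so-called associated pressure `p`
and, since `|div v ⊗ v| ∈ L_{4/3}(Q_T)`, we find (3.2) `v ∈ L₄(Q_T)`,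
`∂ₜv, ∇²v, ∇p ∈ L_{4/3}(Q_{δ₁,T})` for any `δ₁ > 0` […]. The pair `v` and `p` satisfies the
Navier–Stokes equations a.e. in `Q_T`. Moreover, by the pressure equation (3.3)
`Δp = -div div v ⊗ v`, we have (3.4) `p ∈ L_{3/2,∞}(Q_T)`."). Let `ν > 0`, let the datum `a` lie
in `J̊` (square integrable, weakly divergence free: ESS (1.8)), and let `u` be a Leray–Hopf weak
solution of the unforced Cauchy problem on `ℝ³ × [0, T)` with datum `a` and `u ∈ L_{3,∞}(Q_T)`
(1.13). Then there is a pressure `p` with `p ∈ L_{3/2,∞}(Q_T) = L^∞(0, T; L^{3/2}(ℝ³))`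
(accepted guarded mixed class) such that `u`, `p` satisfy the Navier–Stokes equations (viscosity
`ν`, no force) in the sense of distributions on the open strip `Q_T = ]0, T[ × ℝ³` (accepted
`Fluid.IsDistributionalNSSolutionOn` on `Fluid.slab`; implied by "a.e. in `Q_T`" with (3.2)).
Only this part of (3.2)–(3.4) is vendored. ESS take `ν = 1`; the general case is the rescaling
`w(s, y) = ν⁻¹ u(s/ν, y)`, `q(s, y) = ν⁻² p(s/ν, y)` as for `ess_sup_bound`. [cite: EscauriazaSereginSverak2003, §3 (3.2)–(3.4)] -/
def ess_associated_pressure : Prop :=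
  ∀ {ν T : ℝ} (_hν : 0 < ν) (_hT : 0 < T) {u₀ : ℝ³ → ℝ³} {u : ℝ → ℝ³ → ℝ³}
    (_hu₀ : MemLp u₀ 2 volume) (_hdiv : FluidPDE.IsWeaklyDivFree u₀)
    (_hu : FluidPDE.IsLerayHopfOn T ν 0 u₀ u) (_h₃ : FluidPDE.MemLqLp ∞ 3 u (Ioo 0 T)),
    ∃ p : ℝ → ℝ³ → ℝ, FluidPDE.MemLqLp ∞ (3 / 2) p (Ioo 0 T) ∧
      FluidPDE.IsDistributionalNSSolutionOn (FluidPDE.slab ℝ³ (Ioo 0 T) isOpen_Ioo) ν 0 u p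

/-! ### The hypotheses of Theorem 1.4 on a viscous cylinder, and their rescaling -/

/-- **The hypotheses (1.15)–(1.16) of ESS Thm. 1.4 on the viscous cylinder `Q_ν(z₀, R)`**
(Escauriaza–Seregin–Šverák 2003, Thm. 1.4 and §3, (3.5): the conditions verified by the rescaled
pair): `(u, p)` solves the Navier–Stokes system with viscosity `ν` (no force) in the sense of
distributions in `Q_ν(z₀, R) = ]t₀ - R²/ν, t₀[ × B(x₀, R)`, `u ∈ L_{2,∞}` and `u ∈ L_{3,∞}` there
(sliced bounds over `B(x₀, R)` for a.e. `t`), `u` has a square-integrable weak spatial gradient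
on the cylinder, and `p ∈ L_{3/2}` of the cylinder. For `ν = R = 1`, `z₀ = 0` these are exactly
the hypotheses of `NS.ess_local_holder` / `NS.ess_suitable_of_L3infty` (`unit_iff`). [cite: EscauriazaSereginSverak2003, Thm. 1.4 (1.15)–(1.16)] -/
structure IsL3inftyLocalPair (ν R : ℝ) (z₀ : ℝ × ℝ³) (u : ℝ → ℝ³ → ℝ³) (p : ℝ → ℝ³ → ℝ) :
    Prop where
  /-- The system holds in the sense of distributions in `Q_ν(z₀, R)`. -/
  distributional : FluidPDE.IsDistributionalNSSolutionOn (FluidPDE.viscousCylinderOpens ν R z₀) ν 0 u p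
  /-- (1.15), `u ∈ L_{2,∞}(Q_ν(z₀, R))`. -/
  energyClass : ∃ C : ℝ≥0, ∀ᵐ t ∂(volume.restrict (Ioo (z₀.1 - R ^ 2 / ν) z₀.1)),
    ∫⁻ x in ball z₀.2 R, ‖u t x‖ₑ ^ 2 ≤ C
  /-- (1.15), `∇u ∈ L₂(Q_ν(z₀, R))` as a weak spatial gradient. -/
  gradient : ∃ G : ℝ → ℝ³ → ℝ³ →L[ℝ] ℝ³,
    FluidPDE.HasWeakSpatialGradientOn (FluidPDE.viscousCylinderOpens ν R z₀) u G ∧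
    ∫⁻ z in FluidPDE.viscousCylinder ν R z₀, ENNReal.ofReal (FluidPDE.frobeniusNormSq (G z.1 z.2)) < ∞
  /-- (1.15), `p ∈ L_{3/2}(Q_ν(z₀, R))`. -/
  pressure : ∫⁻ z in FluidPDE.viscousCylinder ν R z₀, ‖p z.1 z.2‖ₑ ^ (3 / 2 : ℝ) < ∞
  /-- (1.16), `‖u‖_{3,∞,Q_ν(z₀,R)} < ∞`. -/
  cubicClass : ∃ C : ℝ≥0, ∀ᵐ t ∂(volume.restrict (Ioo (z₀.1 - R ^ 2 / ν) z₀.1)),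
    ∫⁻ x in ball z₀.2 R, ‖u t x‖ₑ ^ 3 ≤ C

/-- The unit viscous cylinder is ESS's `Q = Q(1)`. [folklore] -/
theorem viscousCylinder_one_one_zero :
    FluidPDE.viscousCylinder 1 1 ((0 : ℝ), (0 : ℝ³)) = FluidPDE.parabolicCylinder 1 ((0 : ℝ), (0 : ℝ³)) :=
  FluidPDE.viscousCylinder_one 1 _

/-- The unit viscous cylinder is ESS's `Q = Q(1)` (as open sets). [folklore] -/
theorem viscousCylinderOpens_one_one_zero :
    FluidPDE.viscousCylinderOpens 1 1 ((0 : ℝ), (0 : ℝ³)) =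
      FluidPDE.parabolicCylinderOpens 1 ((0 : ℝ), (0 : ℝ³)) :=
  FluidPDE.viscousCylinderOpens_one 1 _

/-- The time interval of the unit cylinder is `]-1, 0[`. [folklore] -/
theorem unit_time_interval : Ioo ((0 : ℝ) - 1 ^ 2 / 1) 0 = Ioo (-1) 0 := by
  norm_num

/-- At `ν = R = 1`, `z₀ = 0` the bundled hypotheses are those of `ess_local_holder` (the five
hypotheses of ESS Thm. 1.4, in the same rendering). [cite: EscauriazaSereginSverak2003, Thm. 1.4 (1.15)–(1.16)] -/
theorem IsL3inftyLocalPair.unit_iff {u : ℝ → ℝ³ → ℝ³} {p : ℝ → ℝ³ → ℝ} :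
    IsL3inftyLocalPair 1 1 ((0 : ℝ), (0 : ℝ³)) u p ↔
      FluidPDE.IsDistributionalNSSolutionOn (FluidPDE.parabolicCylinderOpens 1 ((0 : ℝ), (0 : ℝ³))) 1 0
          u p ∧
        (∃ C : ℝ≥0, ∀ᵐ t ∂(volume.restrict (Ioo (-1) 0)),
          ∫⁻ x in ball (0 : ℝ³) 1, ‖u t x‖ₑ ^ 2 ≤ C) ∧
        (∃ G : ℝ → ℝ³ → ℝ³ →L[ℝ] ℝ³,
          FluidPDE.HasWeakSpatialGradientOn (FluidPDE.parabolicCylinderOpens 1 ((0 : ℝ), (0 : ℝ³))) u G ∧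
          ∫⁻ z in FluidPDE.parabolicCylinder 1 ((0 : ℝ), (0 : ℝ³)),
            ENNReal.ofReal (FluidPDE.frobeniusNormSq (G z.1 z.2)) < ∞) ∧
        (∫⁻ z in FluidPDE.parabolicCylinder 1 ((0 : ℝ), (0 : ℝ³)), ‖p z.1 z.2‖ₑ ^ (3 / 2 : ℝ) < ∞) ∧
        (∃ C : ℝ≥0, ∀ᵐ t ∂(volume.restrict (Ioo (-1) 0)),
          ∫⁻ x in ball (0 : ℝ³) 1, ‖u t x‖ₑ ^ 3 ≤ C) := by
  rw [← viscousCylinderOpens_one_one_zero, ← viscousCylinder_one_one_zero, ← unit_time_interval]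
  exact ⟨fun h => ⟨h.1, h.2, h.3, h.4, h.5⟩, fun h => ⟨h.1, h.2.1, h.2.2.1, h.2.2.2.1, h.2.2.2.2⟩⟩

section Rescale

variable {ν R t₀ : ℝ} {x₀ : ℝ³} {u : ℝ → ℝ³ → ℝ³} {p : ℝ → ℝ³ → ℝ}

/-- `dim ℝ³ = 3`. [folklore] -/
theorem finrank_euclideanSpace_fin_three : finrank ℝ ℝ³ = 3 := by
  simp

/-- The preimage of `Q_ν(z₀, ρ)` under the viscosity-normalising map at scale `R` is the
standard cylinder `Q(ρ/R)` (accepted `Fluid.stAffine_preimage_cylinder_eq_parabolicCylinder`). [folklore] -/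
theorem stAffine_preimage_viscousCylinder (hν : 0 < ν) (hR : 0 < R) (t₀ : ℝ) (x₀ : ℝ³) (ρ : ℝ) :
    FluidPDE.stAffine (R ^ 2 / ν) R t₀ x₀ ⁻¹' FluidPDE.viscousCylinder ν ρ (t₀, x₀) =
      FluidPDE.parabolicCylinder (ρ / R) ((0 : ℝ), (0 : ℝ³)) :=
  FluidPDE.stAffine_preimage_cylinder_eq_parabolicCylinder hν hR t₀ x₀ ρ

/-- In particular `Φ⁻¹(Q_ν(z₀, R)) = Q(1)` … [folklore] -/
theorem stAffine_preimage_viscousCylinder_self (hν : 0 < ν) (hR : 0 < R) (t₀ : ℝ) (x₀ : ℝ³) :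
    FluidPDE.stAffine (R ^ 2 / ν) R t₀ x₀ ⁻¹' FluidPDE.viscousCylinder ν R (t₀, x₀) =
      FluidPDE.viscousCylinder 1 1 ((0 : ℝ), (0 : ℝ³)) := by
  rw [stAffine_preimage_viscousCylinder hν hR, div_self hR.ne', viscousCylinder_one_one_zero]

/-- … and `Φ⁻¹(Q_ν(z₀, R/2)) = Q(1/2)`. [folklore] -/
theorem stAffine_preimage_viscousCylinder_half (hν : 0 < ν) (hR : 0 < R) (t₀ : ℝ) (x₀ : ℝ³) :
    FluidPDE.stAffine (R ^ 2 / ν) R t₀ x₀ ⁻¹' FluidPDE.viscousCylinder ν (R / 2) (t₀, x₀) =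
      FluidPDE.parabolicCylinder (1 / 2) ((0 : ℝ), (0 : ℝ³)) := by
  rw [stAffine_preimage_viscousCylinder hν hR]
  congr 1
  field_simp

/-- The same for the `Opens` versions. [folklore] -/
theorem stPreimage_viscousCylinderOpens_self (hν : 0 < ν) (hR : 0 < R) (t₀ : ℝ) (x₀ : ℝ³) :
    FluidPDE.stPreimage (R ^ 2 / ν) R t₀ x₀ (FluidPDE.viscousCylinderOpens ν R (t₀, x₀)) =
      FluidPDE.viscousCylinderOpens 1 1 ((0 : ℝ), (0 : ℝ³)) :=
  TopologicalSpace.Opens.ext (stAffine_preimage_viscousCylinder_self hν hR t₀ x₀)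

/-- A finite `ℝ≥0∞` a.e. bound can be replaced by an `ℝ≥0` one. [folklore] -/
theorem exists_nnreal_of_ae_le {α : Type*} {m : MeasurableSpace α} {μ : Measure α}
    {f : α → ℝ≥0∞} {K : ℝ≥0∞} (hK : K ≠ ∞) (h : ∀ᵐ a ∂μ, f a ≤ K) :
    ∃ C : ℝ≥0, ∀ᵐ a ∂μ, f a ≤ C :=
  ⟨K.toNNReal, by simpa only [ENNReal.coe_toNNReal hK] using h⟩

/-- **Rescaling of the hypotheses of Thm. 1.4** (ESS 2003, §3: "making obvious scaling […] we
see that the pair `ṽ` and `p̃` satisfies all conditions of Theorem 1.4"). If `(u, p)` satisfies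
(1.15)–(1.16) on `Q_ν(z₀, R)` with viscosity `ν`, then
`w(s, y) = (R/ν) u(t₀ + (R²/ν) s, x₀ + R y)`, `q(s, y) = (R/ν)² p(…)` satisfy them on the unit
cylinder with viscosity `1` (covariance lemmas of `FluidPDE/SpaceTimeRescaling`). Real proof. [cite: EscauriazaSereginSverak2003, §3, proof of (3.5)] -/
theorem IsL3inftyLocalPair.stRescale (h : IsL3inftyLocalPair ν R (t₀, x₀) u p) (hν : 0 < ν)
    (hR : 0 < R) :
    IsL3inftyLocalPair 1 1 ((0 : ℝ), (0 : ℝ³))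
      ((R / ν) • FluidPDE.stPull (R ^ 2 / ν) R t₀ x₀ u)
      ((R / ν) ^ 2 • FluidPDE.stPull (R ^ 2 / ν) R t₀ x₀ p) := by
  have hα : 0 < R / ν := by positivity
  have hβ : 0 < R ^ 2 / ν := by positivity
  have hβ' : R ^ 2 / ν = R / ν * R := by ring
  have hvol : ENNReal.ofReal (R ^ 2 / ν * R ^ finrank ℝ ℝ³)⁻¹ ≠ ∞ := ENNReal.ofReal_ne_top
  -- the time interval of the unit cylinder in the form produced by the transport lemmas
  have hI : Ioo (t₀ - R ^ 2 / ν) t₀ = Ioo (t₀ + R ^ 2 / ν * (-1)) (t₀ + R ^ 2 / ν * 0) := by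
    congr 1 <;> ring
  have hI' : Ioo (((0 : ℝ), (0 : ℝ³)).1 - 1 ^ 2 / 1) ((0 : ℝ), (0 : ℝ³)).1 = Ioo (-1) 0 := by
    norm_num
  have hball : ball (R⁻¹ • (x₀ - x₀)) (R / R) = ball (0 : ℝ³) 1 := by
    rw [sub_self, smul_zero, div_self hR.ne']
  refine ⟨?_, ?_, ?_, ?_, ?_⟩
  · -- (2.3) by covariance of distributional solutions
    have h1 := h.distributional.stRescale hα hR hβ' t₀ x₀
    have e1 : R / ν * ν / R = 1 := by field_simp
    have e2 : ((R / ν) ^ 2 * R) • FluidPDE.stPull (R ^ 2 / ν) R t₀ x₀ (0 : ℝ → ℝ³ → ℝ³) = 0 := by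
      funext s y; simp [FluidPDE.stPull]
    rw [e1, e2, stPreimage_viscousCylinderOpens_self hν hR] at h1
    exact h1
  · -- (1.15), sliced `L²` bound
    obtain ⟨C, hC⟩ := h.energyClass
    rw [hI] at hC
    have h1 := FluidPDE.ae_sliced_setLIntegral_ball_stRescale hβ hR t₀ x₀ x₀ R (-1) 0
      (fun t x => ‖u t x‖ₑ ^ 2) hC
    rw [hball] at h1
    rw [hI']
    refine exists_nnreal_of_ae_le (K := ‖R / ν‖ₑ ^ 2 * (ENNReal.ofReal (R ^ finrank ℝ ℝ³)⁻¹ * C))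
      (ENNReal.mul_ne_top (by simp) (ENNReal.mul_ne_top ENNReal.ofReal_ne_top ENNReal.coe_ne_top)) ?_
    filter_upwards [h1] with s hs
    have e : ∀ y : ℝ³, ‖((R / ν) • FluidPDE.stPull (R ^ 2 / ν) R t₀ x₀ u) s y‖ₑ ^ 2 =
        ‖R / ν‖ₑ ^ 2 * ‖u (t₀ + R ^ 2 / ν * s) (x₀ + R • y)‖ₑ ^ 2 := by
      intro y
      rw [FluidPDE.smul_stPull_apply, enorm_smul, mul_pow]
    simp_rw [e]
    rw [lintegral_const_mul' _ _ (by simp)]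
    exact mul_le_mul_right hs _
  · -- (1.15), the weak spatial gradient and its square integrability
    obtain ⟨G, hG, hG2⟩ := h.gradient
    refine ⟨(R / ν * R) • FluidPDE.stPull (R ^ 2 / ν) R t₀ x₀ G, ?_, ?_⟩
    · have h1 := hG.stRescale (R / ν) hβ hR t₀ x₀
      rwa [stPreimage_viscousCylinderOpens_self hν hR] at h1
    · rw [← stAffine_preimage_viscousCylinder_self hν hR t₀ x₀,
        FluidPDE.setLIntegral_frobeniusNormSq_stRescale hβ hR]
      exact ENNReal.mul_lt_top (ENNReal.mul_lt_top ENNReal.ofReal_lt_top ENNReal.ofReal_lt_top) hG2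
  · -- (1.15), `p ∈ L_{3/2}`
    have hp := h.pressure
    rw [← stAffine_preimage_viscousCylinder_self hν hR t₀ x₀,
      FluidPDE.setLIntegral_enorm_rpow_stRescale hβ hR t₀ x₀ ((R / ν) ^ 2) p _ (by norm_num)]
    exact ENNReal.mul_lt_top (ENNReal.mul_lt_top
      (ENNReal.rpow_lt_top_of_nonneg (by norm_num) enorm_ne_top) ENNReal.ofReal_lt_top) hp
  · -- (1.16), sliced `L³` bound
    obtain ⟨C, hC⟩ := h.cubicClass
    rw [hI] at hC
    have h1 := FluidPDE.ae_sliced_setLIntegral_ball_stRescale hβ hR t₀ x₀ x₀ R (-1) 0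
      (fun t x => ‖u t x‖ₑ ^ 3) hC
    rw [hball] at h1
    rw [hI']
    refine exists_nnreal_of_ae_le (K := ‖R / ν‖ₑ ^ 3 * (ENNReal.ofReal (R ^ finrank ℝ ℝ³)⁻¹ * C))
      (ENNReal.mul_ne_top (by simp) (ENNReal.mul_ne_top ENNReal.ofReal_ne_top ENNReal.coe_ne_top)) ?_
    filter_upwards [h1] with s hs
    have e : ∀ y : ℝ³, ‖((R / ν) • FluidPDE.stPull (R ^ 2 / ν) R t₀ x₀ u) s y‖ₑ ^ 3 =
        ‖R / ν‖ₑ ^ 3 * ‖u (t₀ + R ^ 2 / ν * s) (x₀ + R • y)‖ₑ ^ 3 := by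
      intro y
      rw [FluidPDE.smul_stPull_apply, enorm_smul, mul_pow]
    simp_rw [e]
    rw [lintegral_const_mul' _ _ (by simp)]
    exact mul_le_mul_right hs _

/-! ### Theorem 1.4 and Lemma 2.2 on viscous cylinders -/

/-- **ESS Thm. 1.4, rescaled** (Escauriaza–Seregin–Šverák 2003, §3, proof of (3.5): "this means
that `ṽ` is Hölder continuous in `Q̄(1/2)` and therefore `v` is Hölder continuous in
`Q̄(z₀, R/2)`"). If `(u, p)` satisfies the hypotheses (1.15)–(1.16) of Thm. 1.4 on the viscous
cylinder `Q_ν(z₀, R)` (viscosity `ν > 0`), then `u` is essentially bounded on `Q_ν(z₀, R/2)`: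
the rescaled pair satisfies the hypotheses of `ess_local_holder` on the unit cylinder, its
Hölder continuous representative is bounded on the compact closure of `Q(1/2)`, and the a.e.
bound is transported back along the measure-scaling affine map. Real proof from the named fact
`ess_local_holder`. [cite: EscauriazaSereginSverak2003, §3 (3.5)] -/
theorem IsL3inftyLocalPair.exists_ae_bound (hLH : ess_local_holder)
    (h : IsL3inftyLocalPair ν R (t₀, x₀) u p) (hν : 0 < ν) (hR : 0 < R) :
    ∃ M : ℝ, ∀ᵐ z ∂(volume.restrict (FluidPDE.viscousCylinder ν (R / 2) (t₀, x₀))),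
      ‖u z.1 z.2‖ ≤ M := by
  have hα : 0 < R / ν := by positivity
  have hβ : 0 < R ^ 2 / ν := by positivity
  obtain ⟨h1, h2, h3, h4, h5⟩ := (IsL3inftyLocalPair.unit_iff).1 (h.stRescale hν hR)
  obtain ⟨w, C, a, ha, hw, hae⟩ := hLH _ _ h1 h2 h3 h4 h5
  set Q₂ := FluidPDE.parabolicCylinder (1 / 2) ((0 : ℝ), (0 : ℝ³)) with hQ₂
  have hcpt : IsCompact (closure Q₂) :=
    (Metric.isBounded_Ioo _ _).prod Metric.isBounded_ball |>.isCompact_closure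
  obtain ⟨M, hM⟩ := hcpt.exists_bound_of_continuousOn (hw.continuousOn (by exact_mod_cast ha))
  have hae' : ∀ᵐ z ∂(volume.restrict Q₂),
      ‖(R / ν) • u (FluidPDE.stAffine (R ^ 2 / ν) R t₀ x₀ z).1
        (FluidPDE.stAffine (R ^ 2 / ν) R t₀ x₀ z).2‖ ≤ M := by
    filter_upwards [hae, ae_restrict_mem (measurableSet_Ioo.prod measurableSet_ball)] with z hz hzQ
    have e : uncurry ((R / ν) • FluidPDE.stPull (R ^ 2 / ν) R t₀ x₀ u) z =
        (R / ν) • u (FluidPDE.stAffine (R ^ 2 / ν) R t₀ x₀ z).1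
          (FluidPDE.stAffine (R ^ 2 / ν) R t₀ x₀ z).2 := rfl
    rw [← e, hz]
    exact hM z (subset_closure hzQ)
  rw [hQ₂, ← stAffine_preimage_viscousCylinder_half hν hR t₀ x₀] at hae'
  have h6 := FluidPDE.ae_restrict_of_ae_restrict_preimage_stAffine hβ hR t₀ x₀
    (P := fun z => ‖(R / ν) • u z.1 z.2‖ ≤ M) hae'
  refine ⟨M / (R / ν), ?_⟩
  filter_upwards [h6] with z hz
  rw [norm_smul, Real.norm_eq_abs, abs_of_pos hα] at hz
  rw [le_div_iff₀ hα, mul_comm]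
  exact hz

/-- `((R/ν)²)^{3/2} = (R/ν)³`-type identity: `(α²)^{3/2} = α³` for `α ≥ 0`. [folklore] -/
theorem sq_rpow_three_halves {α : ℝ} (hα : 0 ≤ α) : (α ^ 2) ^ (3 / 2 : ℝ) = α ^ 3 := by
  rw [show α ^ 2 = α ^ (2 : ℝ) by norm_cast, ← Real.rpow_mul hα,
    show (2 : ℝ) * (3 / 2) = (3 : ℕ) by norm_num, Real.rpow_natCast]

/-- The smallness quantity of Lemma 2.2 under the viscosity-normalising rescaling:
`∫_Q (|w|³ + |q|^{3/2}) = (ν R)⁻² ∫_{Q_ν(z₀,R)} (|u|³ + |p|^{3/2})` for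
`w = (R/ν) u ∘ Φ`, `q = (R/ν)² p ∘ Φ` (pointwise `|w|³ + |q|^{3/2} = (R/ν)³ (|u|³ + |p|^{3/2}) ∘ Φ`
since `((R/ν)²)^{3/2} = (R/ν)³`, and `dz = (R⁵/ν) dz'`). No measurability is needed. [folklore] -/
theorem lintegral_cubic_add_pressure_stRescale (hν : 0 < ν) (hR : 0 < R) (t₀ : ℝ) (x₀ : ℝ³)
    (u : ℝ → ℝ³ → ℝ³) (p : ℝ → ℝ³ → ℝ) :
    ∫⁻ z in FluidPDE.parabolicCylinder 1 ((0 : ℝ), (0 : ℝ³)),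
        (‖((R / ν) • FluidPDE.stPull (R ^ 2 / ν) R t₀ x₀ u) z.1 z.2‖ₑ ^ 3 +
          ‖((R / ν) ^ 2 • FluidPDE.stPull (R ^ 2 / ν) R t₀ x₀ p) z.1 z.2‖ₑ ^ (3 / 2 : ℝ)) =
      ENNReal.ofReal ((ν ^ 2 * R ^ 2)⁻¹) *
        ∫⁻ z in FluidPDE.viscousCylinder ν R (t₀, x₀),
          (‖u z.1 z.2‖ₑ ^ 3 + ‖p z.1 z.2‖ₑ ^ (3 / 2 : ℝ)) := by
  have hα : 0 < R / ν := by positivity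
  have hβ : 0 < R ^ 2 / ν := by positivity
  set F : ℝ × ℝ³ → ℝ≥0∞ := fun z => ‖u z.1 z.2‖ₑ ^ 3 + ‖p z.1 z.2‖ₑ ^ (3 / 2 : ℝ) with hF
  have key : ∀ z : ℝ × ℝ³,
      ‖((R / ν) • FluidPDE.stPull (R ^ 2 / ν) R t₀ x₀ u) z.1 z.2‖ₑ ^ 3 +
          ‖((R / ν) ^ 2 • FluidPDE.stPull (R ^ 2 / ν) R t₀ x₀ p) z.1 z.2‖ₑ ^ (3 / 2 : ℝ) =
        ENNReal.ofReal ((R / ν) ^ 3) * F (FluidPDE.stAffine (R ^ 2 / ν) R t₀ x₀ z) := by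
    intro z
    have e1 : ((R / ν) • FluidPDE.stPull (R ^ 2 / ν) R t₀ x₀ u) z.1 z.2 =
        (R / ν) • u (t₀ + R ^ 2 / ν * z.1) (x₀ + R • z.2) := rfl
    have e2 : ((R / ν) ^ 2 • FluidPDE.stPull (R ^ 2 / ν) R t₀ x₀ p) z.1 z.2 =
        (R / ν) ^ 2 • p (t₀ + R ^ 2 / ν * z.1) (x₀ + R • z.2) := rfl
    have e3 : ‖R / ν‖ₑ ^ 3 = ENNReal.ofReal ((R / ν) ^ 3) := by
      rw [Real.enorm_eq_ofReal hα.le, ENNReal.ofReal_pow hα.le]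
    have e4 : ‖(R / ν) ^ 2‖ₑ ^ (3 / 2 : ℝ) = ENNReal.ofReal ((R / ν) ^ 3) := by
      rw [Real.enorm_eq_ofReal (sq_nonneg _), ENNReal.ofReal_rpow_of_nonneg (sq_nonneg _)
        (by norm_num), sq_rpow_three_halves hα.le]
    rw [e1, e2, enorm_smul, enorm_smul, mul_pow, ENNReal.mul_rpow_of_nonneg _ _ (by norm_num),
      e3, e4, ← mul_add, hF]
    rfl
  simp_rw [key]
  rw [← viscousCylinder_one_one_zero, ← stAffine_preimage_viscousCylinder_self hν hR t₀ x₀,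
    lintegral_const_mul' _ _ ENNReal.ofReal_ne_top,
    FluidPDE.setLIntegral_preimage_comp_stAffine hβ hR t₀ x₀ F, ← mul_assoc,
    ← ENNReal.ofReal_mul (by positivity), finrank_euclideanSpace_fin_three]
  congr 2
  field_simp

-- `linter.deprecated` is switched off for the next declaration only: its hypothesis `hS` is the
-- refuted, deprecated (2026-08-16) `ess_suitable_of_L3infty`; the implication is kept verbatim for
-- its importer `FluidPDE/NSEssSupBound` and deprecated itself. REMOVE-WHEN that `def` is deleted.
set_option linter.deprecated false in
/-- **Deprecated (2026-08-16) together with its hypothesis `hS : ess_suitable_of_L3infty`, which is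
refuted as stated (`Literature.Analysis.FluidPDE.not_ess_suitable_of_L3infty`,
`FluidPDE/NSSuitableESSRefutation`): a correct but vacuous implication; use
`ess_epsilon_bound_scaled'` (same conclusion from `ess_epsilon_regularity'` and the proved
`ess_suitable_of_L3infty'`).** Statement and proof unchanged.

Original description:
**ESS Lemma 2.2, rescaled** (Escauriaza–Seregin–Šverák 2003, §3, proof of (3.6): "using
scaling arguments, Lemma 2.2 and statement (3.5), we observe that `max |v| < C₁(δ)`"). There are
absolute constants `ε₀, c₀ > 0` (those of `ess_epsilon_regularity`) such that: if `(u, p)`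
satisfies the hypotheses (1.15)–(1.16) of Thm. 1.4 on `Q_ν(z₀, R)` (viscosity `ν > 0`) and
`(ν R)⁻² ∫_{Q_ν(z₀,R)} (|u|³ + |p|^{3/2}) < ε₀`, then `|u| ≤ c₀ ν / R` a.e. on `Q_ν(z₀, R/2)`:
the rescaled pair `w = (R/ν) u ∘ Φ`, `q = (R/ν)² p ∘ Φ` is suitable on the unit cylinder by
`ess_suitable_of_L3infty`, satisfies (2.5) by `lintegral_cubic_add_pressure_stRescale`, hence
`|w| < c₀` on `Q̄(1/2)` by Lemma 2.2, and `|u| = (ν/R) |w ∘ Φ⁻¹|`. Real proof from the two named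
facts. [cite: EscauriazaSereginSverak2003, §3 (3.6)] -/
@[deprecated "vacuous: the hypothesis ess_suitable_of_L3infty is refuted as stated \
  (not_ess_suitable_of_L3infty); use ess_epsilon_bound_scaled'" (since := "2026-08-16")]
theorem ess_epsilon_bound_scaled (hε : ess_epsilon_regularity) (hS : ess_suitable_of_L3infty) :
    ∃ ε₀ c₀ : ℝ, 0 < ε₀ ∧ 0 < c₀ ∧ ∀ {ν R t₀ : ℝ} {x₀ : ℝ³} {u : ℝ → ℝ³ → ℝ³} {p : ℝ → ℝ³ → ℝ},
      0 < ν → 0 < R → IsL3inftyLocalPair ν R (t₀, x₀) u p →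
      ENNReal.ofReal ((ν ^ 2 * R ^ 2)⁻¹) *
          ∫⁻ z in FluidPDE.viscousCylinder ν R (t₀, x₀),
            (‖u z.1 z.2‖ₑ ^ 3 + ‖p z.1 z.2‖ₑ ^ (3 / 2 : ℝ)) < ENNReal.ofReal ε₀ →
      ∀ᵐ z ∂(volume.restrict (FluidPDE.viscousCylinder ν (R / 2) (t₀, x₀))),
        ‖u z.1 z.2‖ ≤ c₀ * ν / R := by
  obtain ⟨ε₀, c₀, hε₀, hc₀, H⟩ := hε
  refine ⟨ε₀, c₀, hε₀, hc₀, ?_⟩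
  intro ν R t₀ x₀ u p hν hR h hsmall
  have hα : 0 < R / ν := by positivity
  have hβ : 0 < R ^ 2 / ν := by positivity
  obtain ⟨h1, h2, h3, h4, h5⟩ := (IsL3inftyLocalPair.unit_iff).1 (h.stRescale hν hR)
  have hsuit := hS _ _ h1 h2 h3 h4 h5
  rw [← lintegral_cubic_add_pressure_stRescale hν hR t₀ x₀ u p] at hsmall
  obtain ⟨w, C, a, ha, hw, hae, hbound⟩ := H _ _ hsuit hsmall
  set Q₂ := FluidPDE.parabolicCylinder (1 / 2) ((0 : ℝ), (0 : ℝ³)) with hQ₂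
  have hae' : ∀ᵐ z ∂(volume.restrict Q₂),
      ‖(R / ν) • u (FluidPDE.stAffine (R ^ 2 / ν) R t₀ x₀ z).1
        (FluidPDE.stAffine (R ^ 2 / ν) R t₀ x₀ z).2‖ ≤ c₀ := by
    filter_upwards [hae, ae_restrict_mem (measurableSet_Ioo.prod measurableSet_ball)] with z hz hzQ
    have e : uncurry ((R / ν) • FluidPDE.stPull (R ^ 2 / ν) R t₀ x₀ u) z =
        (R / ν) • u (FluidPDE.stAffine (R ^ 2 / ν) R t₀ x₀ z).1
          (FluidPDE.stAffine (R ^ 2 / ν) R t₀ x₀ z).2 := rfl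
    rw [← e, hz]
    exact (hbound z (subset_closure hzQ)).le
  rw [hQ₂, ← stAffine_preimage_viscousCylinder_half hν hR t₀ x₀] at hae'
  have h6 := FluidPDE.ae_restrict_of_ae_restrict_preimage_stAffine hβ hR t₀ x₀
    (P := fun z => ‖(R / ν) • u z.1 z.2‖ ≤ c₀) hae'
  filter_upwards [h6] with z hz
  rw [norm_smul, Real.norm_eq_abs, abs_of_pos hα] at hz
  rw [le_div_iff₀ hR]
  calc ‖u z.1 z.2‖ * R = ν * (R / ν * ‖u z.1 z.2‖) := by field_simp
    _ ≤ ν * c₀ := by gcongr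
    _ = c₀ * ν := mul_comm _ _

end Rescale

end Literature.Analysis.FluidPDE

/-! ### Corrected rendering of ESS Def. 2.1 (2.4): parenthesised sliced local energy inequality -/

namespace Literature.Analysis.FluidPDE

section SuitableESS

variable {E : Type*} [NormedAddCommGroup E] [InnerProductSpace ℝ E] [FiniteDimensional ℝ E]
  [MeasurableSpace E] [BorelSpace E]

/-- **Suitable weak solutions in the sense of Escauriaza–Seregin–Šverák, Def. 2.1 — corrected
rendering of (2.4).** Same data and clauses (2.1)–(2.3) as the accepted `Fluid.IsSuitablePairOn`;
the sliced local energy inequality (2.4) is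
`(∫_ω φ |u|²(t) dx) + 2ν (∫_a^t ∫_ω φ |∇u|²) ≤ ∫_a^t ∫_ω (|u|² (νΔφ + ∂ₜφ) + u·∇φ (|u|² + 2p))`
for a.e. `t ∈ ]a, b[` and every nonnegative test function `φ` on `]a, ∞[ × ω`, with the
left-hand side **parenthesised as printed**. (In `Fluid.IsSuitablePairOn.localEnergy` the
unparenthesised `∫ x in ω, φ t x * ‖u t x‖ ^ 2 + 2 * ν * ∫∫ …` lets the `x`-integral extend
over the whole sum, i.e. the dissipation term is integrated once more over `ω`; that clause is
ESS (2.4) only when `|ω| = 1`, which fails for the unit ball of `ℝ³`.) ESS print `ν = 1`. [cite: EscauriazaSereginSverak2003, Def. 2.1] -/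
structure IsESSSuitablePairOn (ω : Opens E) (a b : ℝ) (ν : ℝ) (u : ℝ → E → E) (p : ℝ → E → ℝ) :
    Prop where
  /-- (2.1), first half: `u ∈ L_{2,∞}(ω × ]a, b[)`, `ess sup_{a<t<b} ∫_ω |u(t, x)|² dx < ∞`. -/
  energyClass : ∃ C : ℝ≥0, ∀ᵐ t ∂(volume.restrict (Ioo a b)),
    ∫⁻ x in (ω : Set E), ‖u t x‖ₑ ^ 2 ≤ C
  /-- (2.2): `p ∈ L_{3/2}(ω × ]a, b[)`. -/
  pressure : ∫⁻ z in Ioo a b ×ˢ (ω : Set E), ‖p z.1 z.2‖ₑ ^ (3 / 2 : ℝ) < ∞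
  /-- (2.3): the Navier–Stokes equations hold in the sense of distributions on `ω × ]a, b[`. -/
  distributional : IsDistributionalNSSolutionOn (timeCylinder ω a b) ν 0 u p
  /-- (2.1), second half, and (2.4) (parenthesised as printed), bundled under one existential:
  `u` has a weak spatial gradient `G` on the cylinder with `∫∫ |G|² < ∞`, and for a.e.
  `t ∈ ]a, b[` the sliced local energy inequality holds for every nonnegative test function on
  `]a, ∞[ × ω`, with `G` in place of `∇u`. -/
  localEnergy : ∃ G : ℝ → E → E →L[ℝ] E, HasWeakSpatialGradientOn (timeCylinder ω a b) u G ∧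
    (∫⁻ z in Ioo a b ×ˢ (ω : Set E), ENNReal.ofReal (frobeniusNormSq (G z.1 z.2)) < ∞) ∧
    ∀ᵐ t ∂(volume.restrict (Ioo a b)), ∀ φ : ℝ → E → ℝ,
      IsSpaceTimeTestOn (forwardCylinder ω a) φ → (∀ s y, 0 ≤ φ s y) →
      (∫ x in (ω : Set E), φ t x * ‖u t x‖ ^ 2) +
          2 * ν * (∫ z in Ioo a t ×ˢ (ω : Set E), φ z.1 z.2 * frobeniusNormSq (G z.1 z.2)) ≤
        ∫ z in Ioo a t ×ˢ (ω : Set E),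
          (‖u z.1 z.2‖ ^ 2 * (ν * Δ (φ z.1) z.2 + timeDeriv φ z.1 z.2) +
            ⟪u z.1 z.2, gradient (φ z.1) z.2⟫ * (‖u z.1 z.2‖ ^ 2 + 2 * p z.1 z.2))

variable {ω : Opens E} {a b ν : ℝ} {u : ℝ → E → E} {p : ℝ → E → ℝ}

/-- A (corrected) ESS-suitable pair has a square-integrable weak spatial gradient on the
cylinder ((2.1), second half; projection dropping (2.4)). [cite: EscauriazaSereginSverak2003, Def. 2.1 (2.1)] -/
theorem IsESSSuitablePairOn.exists_hasWeakSpatialGradientOn (h : IsESSSuitablePairOn ω a b ν u p) :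
    ∃ G : ℝ → E → E →L[ℝ] E, HasWeakSpatialGradientOn (timeCylinder ω a b) u G ∧
      ∫⁻ z in Ioo a b ×ˢ (ω : Set E), ENNReal.ofReal (frobeniusNormSq (G z.1 z.2)) < ∞ := by
  obtain ⟨G, hG, hG2, -⟩ := h.localEnergy
  exact ⟨G, hG, hG2⟩

/-- A (corrected) ESS-suitable pair solves the system in the sense of distributions on every
open subset of its cylinder (projection of (2.3) and the accepted restriction
`IsDistributionalNSSolutionOn.mono_holds`). [cite: EscauriazaSereginSverak2003, Def. 2.1 (2.3)] -/
theorem IsESSSuitablePairOn.isDistributionalNSSolutionOn_of_le (h : IsESSSuitablePairOn ω a b ν u p)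
    {Q : Opens (ℝ × E)} (hQ : Q ≤ timeCylinder ω a b) : IsDistributionalNSSolutionOn Q ν 0 u p :=
  h.distributional.of_le hQ

end SuitableESS

end Literature.Analysis.FluidPDE

namespace Literature.Analysis.FluidPDE

/-- Local notation for physical space `ℝ³ = EuclideanSpace ℝ (Fin 3)`. -/
local notation "ℝ³" => EuclideanSpace ℝ (Fin 3)

/-! ### Lemma 2.2 and the first paragraph of the proof of Thm. 1.4 over the corrected predicate -/

/-- **ε-regularity** (Escauriaza–Seregin–Šverák 2003, Lemma 2.2, case `k = 1`; Caffarelli–Kohn–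
Nirenberg 1982, Cor. 1; Ladyzhenskaya–Seregin 1999, Lemma 3.1; Seregin 2014, Lemma 6.1), **over
the corrected rendering `Fluid.IsESSSuitablePairOn` of ESS Def. 2.1** (the accepted
`NS.ess_epsilon_regularity` is the same statement over `Fluid.IsSuitablePairOn`, whose clause
(2.4) integrates the dissipation term once more over `ω`; see the module docstring). There exist
absolute positive constants `ε₀` and `c₀₁` such that: if `U`, `P` is a suitable weak solution
(Def. 2.1, `ν = 1`) in `Q = B × ]-1, 0[` with (2.5) `∫_Q (|U|³ + |P|^{3/2}) dz < ε₀`, then `U` is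
Hölder continuous in the closure of `Q(1/2)` and (2.6) `max_{Q̄(1/2)} |U| < c₀₁` (rendered through
a Hölder representative `w`). [cite: EscauriazaSereginSverak2003, Lemma 2.2] -/
def ess_epsilon_regularity' : Prop :=
  ∃ ε₀ c₀ : ℝ, 0 < ε₀ ∧ 0 < c₀ ∧ ∀ (U : ℝ → ℝ³ → ℝ³) (P : ℝ → ℝ³ → ℝ),
    FluidPDE.IsESSSuitablePairOn unitBall (-1) 0 1 U P →
    ∫⁻ z in FluidPDE.parabolicCylinder 1 ((0 : ℝ), (0 : ℝ³)),
        (‖U z.1 z.2‖ₑ ^ 3 + ‖P z.1 z.2‖ₑ ^ (3 / 2 : ℝ)) < ENNReal.ofReal ε₀ →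
    ∃ (w : ℝ × ℝ³ → ℝ³) (C α : ℝ≥0), 0 < α ∧
      HolderOnWith C α w (closure (FluidPDE.parabolicCylinder (1 / 2) ((0 : ℝ), (0 : ℝ³)))) ∧
      uncurry U =ᵐ[volume.restrict (FluidPDE.parabolicCylinder (1 / 2) ((0 : ℝ), (0 : ℝ³)))] w ∧
      ∀ z ∈ closure (FluidPDE.parabolicCylinder (1 / 2) ((0 : ℝ), (0 : ℝ³))), ‖w z‖ < c₀

/-- **Pairs with (1.15)–(1.16) are suitable weak solutions** (Escauriaza–Seregin–Šverák 2003,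
proof of Thm. 1.4, first paragraph: "First, we note that `v` and `p`, satisfying conditions
(1.15) and (1.16), form a suitable weak solution to the Navier–Stokes equations in `Q`. This can
be verified with the help of usual mollification and the fact `v ∈ L₄(Q)`."), **with the
conclusion in the corrected rendering `Fluid.IsESSSuitablePairOn` of Def. 2.1.** The accepted
`NS.ess_suitable_of_L3infty` concludes `Fluid.IsSuitablePairOn`, whose clause (2.4) carries the
dissipation term integrated once more over the unit ball (factor `|B(1)| = 4π/3`); since the
local energy *equality* holds for the pairs in question, that version fails whenever
`∫∫ φ |∇v|² > 0`, and it is superseded by the present statement. Hypotheses verbatim those of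
`NS.ess_local_holder` (Thm. 1.4, `ν = 1`). [cite: EscauriazaSereginSverak2003, §3, proof of Thm. 1.4, first paragraph] -/
def ess_suitable_of_L3infty' : Prop :=
  ∀ (v : ℝ → ℝ³ → ℝ³) (p : ℝ → ℝ³ → ℝ),
    FluidPDE.IsDistributionalNSSolutionOn (FluidPDE.parabolicCylinderOpens 1 ((0 : ℝ), (0 : ℝ³))) 1 0
      v p →
    (∃ C : ℝ≥0, ∀ᵐ t ∂(volume.restrict (Ioo (-1) 0)),
      ∫⁻ x in ball (0 : ℝ³) 1, ‖v t x‖ₑ ^ 2 ≤ C) →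
    (∃ G : ℝ → ℝ³ → ℝ³ →L[ℝ] ℝ³,
      FluidPDE.HasWeakSpatialGradientOn (FluidPDE.parabolicCylinderOpens 1 ((0 : ℝ), (0 : ℝ³))) v G ∧
      ∫⁻ z in FluidPDE.parabolicCylinder 1 ((0 : ℝ), (0 : ℝ³)),
        ENNReal.ofReal (FluidPDE.frobeniusNormSq (G z.1 z.2)) < ∞) →
    (∫⁻ z in FluidPDE.parabolicCylinder 1 ((0 : ℝ), (0 : ℝ³)), ‖p z.1 z.2‖ₑ ^ (3 / 2 : ℝ) < ∞) →
    (∃ C : ℝ≥0, ∀ᵐ t ∂(volume.restrict (Ioo (-1) 0)),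
      ∫⁻ x in ball (0 : ℝ³) 1, ‖v t x‖ₑ ^ 3 ≤ C) →
    FluidPDE.IsESSSuitablePairOn unitBall (-1) 0 1 v p

/-- **ESS Lemma 2.2, rescaled, over the corrected predicate** (Escauriaza–Seregin–Šverák 2003,
§3, proof of (3.6)): the statement of `ess_epsilon_bound_scaled`, proved from
`ess_epsilon_regularity'` and `ess_suitable_of_L3infty'` by the same scaling argument (the
rescaled pair is suitable on the unit cylinder by `ess_suitable_of_L3infty'`, satisfies (2.5) by
`lintegral_cubic_add_pressure_stRescale`, hence `|w| < c₀` on `Q̄(1/2)` by Lemma 2.2, and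
`|u| = (ν/R) |w ∘ Φ⁻¹|`). [cite: EscauriazaSereginSverak2003, §3 (3.6)] -/
theorem ess_epsilon_bound_scaled' (hε : ess_epsilon_regularity') (hS : ess_suitable_of_L3infty') :
    ∃ ε₀ c₀ : ℝ, 0 < ε₀ ∧ 0 < c₀ ∧ ∀ {ν R t₀ : ℝ} {x₀ : ℝ³} {u : ℝ → ℝ³ → ℝ³} {p : ℝ → ℝ³ → ℝ},
      0 < ν → 0 < R → IsL3inftyLocalPair ν R (t₀, x₀) u p →
      ENNReal.ofReal ((ν ^ 2 * R ^ 2)⁻¹) *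
          ∫⁻ z in FluidPDE.viscousCylinder ν R (t₀, x₀),
            (‖u z.1 z.2‖ₑ ^ 3 + ‖p z.1 z.2‖ₑ ^ (3 / 2 : ℝ)) < ENNReal.ofReal ε₀ →
      ∀ᵐ z ∂(volume.restrict (FluidPDE.viscousCylinder ν (R / 2) (t₀, x₀))),
        ‖u z.1 z.2‖ ≤ c₀ * ν / R := by
  obtain ⟨ε₀, c₀, hε₀, hc₀, H⟩ := hε
  refine ⟨ε₀, c₀, hε₀, hc₀, ?_⟩
  intro ν R t₀ x₀ u p hν hR h hsmall
  have hα : 0 < R / ν := by positivity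
  have hβ : 0 < R ^ 2 / ν := by positivity
  obtain ⟨h1, h2, h3, h4, h5⟩ := (IsL3inftyLocalPair.unit_iff).1 (h.stRescale hν hR)
  have hsuit := hS _ _ h1 h2 h3 h4 h5
  rw [← lintegral_cubic_add_pressure_stRescale hν hR t₀ x₀ u p] at hsmall
  obtain ⟨w, C, a, ha, hw, hae, hbound⟩ := H _ _ hsuit hsmall
  set Q₂ := FluidPDE.parabolicCylinder (1 / 2) ((0 : ℝ), (0 : ℝ³)) with hQ₂
  have hae' : ∀ᵐ z ∂(volume.restrict Q₂),
      ‖(R / ν) • u (FluidPDE.stAffine (R ^ 2 / ν) R t₀ x₀ z).1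
        (FluidPDE.stAffine (R ^ 2 / ν) R t₀ x₀ z).2‖ ≤ c₀ := by
    filter_upwards [hae, ae_restrict_mem (measurableSet_Ioo.prod measurableSet_ball)] with z hz hzQ
    have e : uncurry ((R / ν) • FluidPDE.stPull (R ^ 2 / ν) R t₀ x₀ u) z =
        (R / ν) • u (FluidPDE.stAffine (R ^ 2 / ν) R t₀ x₀ z).1
          (FluidPDE.stAffine (R ^ 2 / ν) R t₀ x₀ z).2 := rfl
    rw [← e, hz]
    exact (hbound z (subset_closure hzQ)).le
  rw [hQ₂, ← stAffine_preimage_viscousCylinder_half hν hR t₀ x₀] at hae'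
  have h6 := FluidPDE.ae_restrict_of_ae_restrict_preimage_stAffine hβ hR t₀ x₀
    (P := fun z => ‖(R / ν) • u z.1 z.2‖ ≤ c₀) hae'
  filter_upwards [h6] with z hz
  rw [norm_smul, Real.norm_eq_abs, abs_of_pos hα] at hz
  rw [le_div_iff₀ hR]
  calc ‖u z.1 z.2‖ * R = ν * (R / ν * ‖u z.1 z.2‖) := by field_simp
    _ ≤ ν * c₀ := by gcongr
    _ = c₀ * ν := mul_comm _ _

end Literature.Analysis.FluidPDE
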